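import Summits.QuantumAdvantage.AdviceFreeQNC0.KFeatureWindow
import Summits.QuantumAdvantage.AdviceFreeQNC0.LevelSetResidueBalance
import HarnessLib

/-!
# Cell qa-qnc0 (rung F-Q1, route RingFrame, crux α `RingToElim`): K-FEATURE WINDOWS AT THE
# VIOLA–WIGDERSON BUDGET — features of degree `d`, up to `L/(2·4^d) − 3` of them

The K-feature window theorem T9 (`kFeatureWindowSqrt`, `KFeatureWindow.lean`) beats a walk strategy
as soon as, on some window `a ++ x(L) ++ h ++ z(M) ++ b`, the cuts strictly inside the `z`-block
read the `x`-block only through `K` Boolean features of degree `≤ D`, with the PLDAMS budget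
`K·D ≤ c₁√L` — the budget at which class balance on ARBITRARY degree-`K·D` atoms ends
(`PLDAMSFence*.lean`).  This file keeps the degree `d` of the FEATURES separate from the degree
`D ≤ c₁√M` of the selectors and replaces PLDAMS by the Viola–Wigderson bound on the level sets of
the feature map (`LevelSetResidueBalance.lean`):

* `lowDegFeatureWindow` — same window, same hypothesis on the `z`-interior cuts, but with the
  budget **`2·4^d·(K + 3) ≤ L`** (so `K` up to `L/(2·4^d) − 3`: LINEAR in `L` for features of constant
  degree, e.g. `K ≤ L/8 − 3` PARITIES) and NO lower bound on `L`; conclusion `#WIN ≤ (1 − η₀/4)·2ⁿ`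
  with the absolute `θ = 1 − η₀/4` of the two-blind-spots theorem (no PLDAMS constant `κ₀`).

Proof: the pointwise one-sided identity `WIN(x, z) = e_x(z) ⊕ B^x_{2|x|}(z)`
(`exists_elimWin_oneSided`), `B^x` constant on the atoms of the feature map; on an atom `A_α`
every offset class holds `≥ #A_α/3 − (2/3)·2^L·e^{−3L/(8·4^d)}` rows (`atom_class_ge`), so the atom
loses `≥ (#A_α/3 − (2/3)2^Lε)·distFail_D(0)` (`potential_cost`); there are `≤ 2^K` atoms and
`2^K·ε ≤ 1/8` (`two_pow_mul_vwErr_le`), so the fibre loses `≥ (2^L/4)·η₀·2^M`.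

Comparison of budgets for `K` features of degree `d`: PLDAMS `K·d ≲ √L` vs. Viola–Wigderson
`K ≲ L/4^d` — the second is larger exactly when `4^d ≲ √L`, i.e. for feature degree
`d ≲ ¼·log₂ L`; at polylog feature degree only PLDAMS says anything.  So the atom road's end
(ROUND-10 §4) depends on the degree of the FEATURES: for constant-degree features it extends to a
linear number of features.  The cell's theorem (prover qn-prover-3 gen 5, 2026-08-27); not in print.
WHAT THIS IS NOT: nothing at polylog feature degree beyond T9; nothing on α proper; no separation.

## References

* E. Viola, A. Wigderson, *Norms, XOR lemmas, and lower bounds for polynomials and protocols*,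
  Theory of Computing 4 (2008), Thm. 2.9 [ViolaWigderson2008].
* S. Srinivasan, *A robust version of Hegedűs's lemma, with applications*, TheoretiCS 2 (2023),
  Lemma 3.1 [Srinivasan2023] (through `elimSqrtDec_of_lowDegAvoidMod3Sparse`).
-/

noncomputable section

namespace Summit.QuantumAdvantage.AdviceFreeQNC0

open Finset
open Literature.Computability.MetaComplexity Literature.Computability.MetaComplexity.Smolensky

variable {L H M : ℕ}

/-! ### Tools -/

/-- Fubini for the window: a count over `{0,1}^{L+H+M}` is the iterated count over `h`, `x`, `z`. -/
private theorem card_filter_window_eq_sum₅ (Q : (Fin (L + H + M) → Bool) → Prop) [DecidablePred Q] :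
    (univ.filter fun v : Fin (L + H + M) → Bool => Q v).card =
      ∑ h : Fin H → Bool, ∑ x : Fin L → Bool,
        (univ.filter fun z : Fin M → Bool => Q (glue3 x h z)).card := by
  rw [card_filter_eq_sum_glue3]
  have hx : ∀ x : Fin L → Bool, ∑ z : Fin M → Bool,
      (univ.filter fun h : Fin H → Bool => Q (glue3 x h z)).card =
      ∑ h : Fin H → Bool, (univ.filter fun z : Fin M → Bool => Q (glue3 x h z)).card := by
    intro x
    simp only [Finset.card_filter]
    rw [Finset.sum_comm]
  rw [Finset.sum_congr rfl fun x _ => hx x, Finset.sum_comm]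

/-- A split `W = e ⊕ B` with `e` an elimination win pattern loses at least `distFail_D(B)`. -/
private theorem distFail_le_loss_of_win_split₅ {D : ℕ} {e B W : (Fin M → Bool) → Bool}
    (he : IsElimWin D e) (hW : ∀ z, W z = xor (e z) (B z)) :
    distFail D B ≤ (univ.filter fun z : Fin M → Bool => W z = false).card := by
  obtain ⟨c₀, a, b, ha, hb, hfe⟩ := he
  have hF : IsElimFail D (elimFail c₀ a b) := ⟨c₀, a, b, ha, hb, fun _ => rfl⟩
  refine le_trans (distFail_le B hF) (le_of_eq (congrArg Finset.card (Finset.filter_congr ?_)))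
  intro z _
  rw [hW z, hfe z]
  cases elimFail c₀ a b z <;> cases B z <;> decide

/-- Regrouping a sum of `f (s x mod 3)` by the residue. -/
private theorem sum_regroup3₅ {X : Type*} (S : Finset X) (s : X → ℕ) (f : ℕ → ℕ) :
    ∑ x ∈ S, f (s x % 3) =
      (S.filter fun x => s x % 3 = 0).card * f 0 + (S.filter fun x => s x % 3 = 1).card * f 1
        + (S.filter fun x => s x % 3 = 2).card * f 2 := by
  classical
  have h1 : ∀ x ∈ S, f (s x % 3) = ∑ r ∈ range 3, (if s x % 3 = r then f r else 0) := by
    intro x _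
    rw [Finset.sum_ite_eq (range 3) (s x % 3) (fun r => f r),
      if_pos (Finset.mem_range.2 (Nat.mod_lt _ (by norm_num)))]
  rw [Finset.sum_congr rfl h1, Finset.sum_comm]
  have h2 : ∀ r, ∑ x ∈ S, (if s x % 3 = r then f r else 0) = (S.filter fun x => s x % 3 = r).card * f r := by
    intro r
    rw [Finset.card_filter, Finset.sum_mul]
    refine Finset.sum_congr rfl fun x _ => ?_
    by_cases hx : s x % 3 = r <;> simp [hx]
  simp only [h2, Finset.sum_range_succ, Finset.sum_range_zero, zero_add]

/-- **The atom step with an additive error.**  If each of the three offset classes of `S` holds at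
least `m` rows (`m` real, possibly negative) and the even triple of potential costs satisfies
`f 0 + f 1 + f 2 ≥ dF`, then `Σ_{x ∈ S} f (s x mod 3) ≥ m·dF`. -/
private theorem atom_step_additive {X : Type*} (S : Finset X) (s : X → ℕ) (f : ℕ → ℕ) (dF : ℕ)
    (hpc : dF ≤ f 0 + f 1 + f 2) (m : ℝ)
    (hP : ∀ r, r < 3 → m ≤ ((S.filter fun x => s x % 3 = r).card : ℝ)) :
    m * (dF : ℝ) ≤ ((∑ x ∈ S, f (s x % 3) : ℕ) : ℝ) := by
  by_cases hm : m ≤ 0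
  · exact le_trans (mul_nonpos_of_nonpos_of_nonneg hm (Nat.cast_nonneg _)) (Nat.cast_nonneg _)
  have hm' : 0 < m := not_le.mp hm
  rw [sum_regroup3₅ S s f]
  push_cast
  have h0 := hP 0 (by norm_num)
  have h1 := hP 1 (by norm_num)
  have h2 := hP 2 (by norm_num)
  have hpc' : (dF : ℝ) ≤ (f 0 : ℝ) + (f 1 : ℝ) + (f 2 : ℝ) := by exact_mod_cast hpc
  have hf0 : (0 : ℝ) ≤ f 0 := Nat.cast_nonneg _
  have hf1 : (0 : ℝ) ≤ f 1 := Nat.cast_nonneg _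
  have hf2 : (0 : ℝ) ≤ f 2 := Nat.cast_nonneg _
  calc m * (dF : ℝ) ≤ m * ((f 0 : ℝ) + f 1 + f 2) := mul_le_mul_of_nonneg_left hpc' hm'.le
    _ = m * f 0 + m * f 1 + m * f 2 := by ring
    _ ≤ ((S.filter fun x => s x % 3 = 0).card : ℝ) * f 0
        + ((S.filter fun x => s x % 3 = 1).card : ℝ) * f 1
        + ((S.filter fun x => s x % 3 = 2).card : ℝ) * f 2 :=
        add_le_add (add_le_add (mul_le_mul_of_nonneg_right h0 hf0) (mul_le_mul_of_nonneg_right h1 hf1))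
          (mul_le_mul_of_nonneg_right h2 hf2)

/-! ### The theorem -/

/-- **K-FEATURE WINDOWS AT THE VIOLA–WIGDERSON BUDGET.**  There are `θ < 1`, `c₁ > 0`, `n₀` such
that: for a window `a(p) ++ x(L) ++ h(H) ++ z(M) ++ b(q)` with `M ≥ n₀`, selector degree
`D ≤ c₁√M`, feature degree `d` and feature number `K` with `2·4^d·(K+3) ≤ L`, every charge `c` and
every walk strategy `y` of degree `≤ D` such that on each fibre `(a, h, b)` the cuts strictly inside
the `z`-block read the `x`-block only through `K` Boolean features of degree `≤ d` (which may
depend on the fibre), the ring game in walk coordinates is won on at most `θ·2ⁿ` inputs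
(`θ = 1 − η₀/4`). [cite: ViolaWigderson2008, Theorem 2.9; Srinivasan2023, Lemma 3.1] -/
theorem lowDegFeatureWindow :
    ∃ θ : ℝ, θ < 1 ∧ ∃ c₁ : ℝ, 0 < c₁ ∧ ∃ n₀ : ℕ, ∀ p L H M q K d : ℕ, n₀ ≤ M →
      ∀ D : ℕ, (D : ℝ) ≤ c₁ * Real.sqrt M → 2 * 4 ^ d * (K + 3) ≤ L →
      ∀ (c : ℕ) (y : Fin (p + (L + H + M) + q + 1) → (Fin (p + (L + H + M) + q) → Bool) → Bool),
        (∀ g, HasDeg (y g) D) →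
        (∀ (a : Fin p → Bool) (h : Fin H → Bool) (b : Fin q → Bool),
          ∃ φ : Fin K → (Fin L → Bool) → Bool, (∀ k, HasDeg (φ k) d) ∧
            ∀ g : Fin (p + (L + H + M) + q + 1), p + (L + H) < g.val → g.val < p + (L + H + M) →
              ∀ (x x' : Fin L → Bool) (z : Fin M → Bool), (∀ k, φ k x = φ k x') →
                y g (glue3 a (glue3 x h z) b) = y g (glue3 a (glue3 x' h z) b)) →
        ((univ.filter fun u : Fin (p + (L + H + M) + q) → Bool => ringWinU c y u = true).card : ℝ) ≤
          θ * (2 : ℝ) ^ (p + (L + H + M) + q) := by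
  classical
  obtain ⟨η₀, hη₀, c₀, hc₀, ℓ₀, HE⟩ := elimSqrtDec_of_lowDegAvoidMod3Sparse lowDegAvoidMod3Sparse
  refine ⟨1 - η₀ / 4, by linarith, c₀, hc₀, ℓ₀, ?_⟩
  intro p L Hm M q K d hM D hD hKL c y hdeg hφ
  -- the Viola–Wigderson budget
  have hbudget : (2 : ℝ) ^ K * vwErr L d ≤ 1 / 8 := two_pow_mul_vwErr_le hKL
  -- elimination hardness on the block
  have hdF : η₀ * (2 : ℝ) ^ M ≤ (distFail D (fun _ : Fin M → Bool => false) : ℝ) :=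
    le_distFail_zero_of fun a b ha hb dec => HE M hM D hD a b ha hb dec
  -- the loss on each fibre `(a, h, b)`
  have hfib : ∀ (a : Fin p → Bool) (h : Fin Hm → Bool) (b : Fin q → Bool),
      1 / 4 * (2 : ℝ) ^ L * (distFail D (fun _ : Fin M → Bool => false) : ℝ) ≤
        ((∑ x : Fin L → Bool, (univ.filter fun z : Fin M → Bool =>
          ringWinU c y (glue3 a (glue3 x h z) b) = false).card : ℕ) : ℝ) := by
    intro a h b
    obtain ⟨φ, hφdeg, hφ'⟩ := hφ a h b
    -- the feature map and its atoms
    set Ψ : (Fin L → Bool) → (Fin K → Bool) := fun x k => φ k x with hΨ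
    -- the interior pattern is constant on atoms
    have hcongr : ∀ x x' : Fin L → Bool, Ψ x = Ψ x' → ∀ s z,
        interiorPat c y a h b x s z = interiorPat c y a h b x' s z := by
      intro x x' hxx' s z
      refine interiorPat_congr c y a h b (fun g h1 h2 z => hφ' g h1 h2 x x' z fun k => ?_) s z
      exact congrFun hxx' k
    -- each row loses at least the potential cost of its interior pattern
    have hrow : ∀ x : Fin L → Bool,
        distFail D (interiorPat c y a h b x ((2 * wt x) % 3)) ≤
          (univ.filter fun z : Fin M → Bool => ringWinU c y (glue3 a (glue3 x h z) b) = false).card := by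
      intro x
      obtain ⟨e, he, hident⟩ := exists_elimWin_oneSided c y hdeg a h b x
      have hmod : interiorPat c y a h b x ((2 * wt x) % 3) = interiorPat c y a h b x (2 * wt x) := by
        funext z; exact (interiorPat_mod c y a h b x (2 * wt x) z).symm
      rw [hmod]
      exact distFail_le_loss_of_win_split₅ he hident
    -- sum the rows atom by atom
    set T : Finset (Fin K → Bool) := (univ : Finset (Fin L → Bool)).image Ψ with hT
    have hsum : (∑ x : Fin L → Bool, distFail D (interiorPat c y a h b x ((2 * wt x) % 3))) =
        ∑ α ∈ T, ∑ x ∈ univ.filter (fun x : Fin L → Bool => Ψ x = α),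
          distFail D (interiorPat c y a h b x ((2 * wt x) % 3)) :=
      (Finset.sum_fiberwise_of_maps_to (fun x hx => Finset.mem_image_of_mem Ψ hx) _).symm
    have hcardsum : ((2 : ℝ) ^ L) = ∑ α ∈ T, ((univ.filter fun x : Fin L → Bool => Ψ x = α).card : ℝ) := by
      have h := (Finset.sum_fiberwise_of_maps_to (s := (univ : Finset (Fin L → Bool))) (t := T)
        (g := Ψ) (fun x hx => Finset.mem_image_of_mem Ψ hx) (fun _ => (1 : ℝ))).symm
      simp only [Finset.sum_const, Finset.card_univ, Fintype.card_fun, Fintype.card_bool,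
        Fintype.card_fin, nsmul_eq_mul, mul_one] at h
      exact_mod_cast h
    have hTcard : (T.card : ℝ) ≤ (2 : ℝ) ^ K := card_image_features_le Ψ
    -- the error per atom
    set E : ℝ := 2 / 3 * ((2 : ℝ) ^ L * vwErr L d) with hE
    have hEnn : 0 ≤ E := by have := vwErr_pos L d; positivity
    -- the atom step
    have hatomstep : ∀ α ∈ T,
        (((univ.filter fun x : Fin L → Bool => Ψ x = α).card : ℝ) / 3 - E) *
            (distFail D (fun _ : Fin M → Bool => false) : ℝ) ≤
          ((∑ x ∈ univ.filter (fun x : Fin L → Bool => Ψ x = α),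
            distFail D (interiorPat c y a h b x ((2 * wt x) % 3)) : ℕ) : ℝ) := by
      intro α hα
      obtain ⟨x₀, -, hx₀⟩ := Finset.mem_image.1 hα
      set S := univ.filter (fun x : Fin L → Bool => Ψ x = α) with hS
      -- on the atom, the pattern is that of the representative
      have hrep : ∀ x ∈ S, distFail D (interiorPat c y a h b x ((2 * wt x) % 3)) =
          distFail D (interiorPat c y a h b x₀ ((2 * wt x) % 3)) := by
        intro x hx
        have hxα : Ψ x = α := (Finset.mem_filter.1 hx).2
        congr 1
        funext z
        exact hcongr x x₀ (hxα.trans hx₀.symm) _ z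
      rw [Finset.sum_congr rfl hrep]
      -- Viola–Wigderson on the atom
      have hP : ∀ r, r < 3 → (S.card : ℝ) / 3 - E ≤ ((S.filter fun x => 2 * wt x % 3 = r).card : ℝ) := by
        intro r hr
        have h := atom_class_ge φ hφdeg α (2 * r)
        have e2 : ((univ.filter fun x : Fin L → Bool => (fun k => φ k x) = α).filter
            fun x => wt x % 3 = 2 * r % 3) = S.filter fun x => 2 * wt x % 3 = r := by
          rw [hS]
          refine Finset.filter_congr fun x _ => ?_
          constructor
          · intro h1; omega
          · intro h1; omega
        rw [e2] at h
        exact h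
      refine atom_step_additive S (fun x => 2 * wt x) (fun r => distFail D (interiorPat c y a h b x₀ r))
        _ ?_ _ hP
      -- the even triple of the representative
      refine potential_cost D _ _ _ fun z => ?_
      have h := interiorPat_even c y a h b x₀ 0 z
      rw [Nat.zero_add, Nat.zero_add] at h
      rw [Bool.xor_assoc]
      exact h
    -- assemble the fibre bound
    have hrows : ((∑ x : Fin L → Bool, distFail D (interiorPat c y a h b x ((2 * wt x) % 3)) : ℕ) : ℝ)
        ≤ ((∑ x : Fin L → Bool, (univ.filter fun z : Fin M → Bool =>
          ringWinU c y (glue3 a (glue3 x h z) b) = false).card : ℕ) : ℝ) := by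
      exact_mod_cast Finset.sum_le_sum fun x _ => hrow x
    refine le_trans ?_ hrows
    rw [hsum]
    push_cast
    have hdF0 : (0 : ℝ) ≤ (distFail D (fun _ : Fin M → Bool => false) : ℝ) := Nat.cast_nonneg _
    -- the total error of the `≤ 2^K` atoms is at most `2^L/12`
    have herr : (T.card : ℝ) * E ≤ (2 : ℝ) ^ L / 12 := by
      calc (T.card : ℝ) * E ≤ (2 : ℝ) ^ K * E := mul_le_mul_of_nonneg_right hTcard hEnn
        _ = 2 / 3 * (2 : ℝ) ^ L * ((2 : ℝ) ^ K * vwErr L d) := by rw [hE]; ring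
        _ ≤ 2 / 3 * (2 : ℝ) ^ L * (1 / 8) := by
            have : (0 : ℝ) ≤ 2 / 3 * (2 : ℝ) ^ L := by positivity
            exact mul_le_mul_of_nonneg_left hbudget this
        _ = (2 : ℝ) ^ L / 12 := by ring
    calc 1 / 4 * (2 : ℝ) ^ L * (distFail D (fun _ : Fin M → Bool => false) : ℝ)
        ≤ ((2 : ℝ) ^ L / 3 - (T.card : ℝ) * E) * (distFail D (fun _ : Fin M → Bool => false) : ℝ) := by
          refine mul_le_mul_of_nonneg_right ?_ hdF0
          linarith
      _ = ∑ α ∈ T, (((univ.filter fun x : Fin L → Bool => Ψ x = α).card : ℝ) / 3 - E) *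
            (distFail D (fun _ : Fin M → Bool => false) : ℝ) := by
          rw [← Finset.sum_mul, Finset.sum_sub_distrib, Finset.sum_const, nsmul_eq_mul,
            ← Finset.sum_div, ← hcardsum]
      _ ≤ ∑ α ∈ T, ((∑ x ∈ univ.filter (fun x : Fin L → Bool => Ψ x = α),
            distFail D (interiorPat c y a h b x ((2 * wt x) % 3)) : ℕ) : ℝ) :=
          Finset.sum_le_sum hatomstep
      _ = _ := by push_cast; rfl
  -- total loss
  have hLsum : (univ.filter fun u : Fin (p + (L + Hm + M) + q) → Bool => ringWinU c y u = false).card =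
      ∑ a : Fin p → Bool, ∑ b : Fin q → Bool, ∑ h : Fin Hm → Bool,
        ∑ x : Fin L → Bool, (univ.filter fun z : Fin M → Bool =>
          ringWinU c y (glue3 a (glue3 x h z) b) = false).card := by
    rw [card_filter_eq_sum_glue3]
    refine Finset.sum_congr rfl fun a _ => Finset.sum_congr rfl fun b _ => ?_
    exact card_filter_window_eq_sum₅ (fun v => ringWinU c y (glue3 a v b) = false)
  have hconst : ∀ (α : Type) [Fintype α] (t : ℝ), ∑ _i : α, t = (Fintype.card α : ℝ) * t := by
    intro α _ t
    rw [Finset.sum_const, Finset.card_univ, nsmul_eq_mul]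
  have hp : (Fintype.card (Fin p → Bool) : ℝ) = (2 : ℝ) ^ p := by
    rw [Fintype.card_fun, Fintype.card_bool, Fintype.card_fin]; push_cast; ring
  have hq : (Fintype.card (Fin q → Bool) : ℝ) = (2 : ℝ) ^ q := by
    rw [Fintype.card_fun, Fintype.card_bool, Fintype.card_fin]; push_cast; ring
  have hH : (Fintype.card (Fin Hm → Bool) : ℝ) = (2 : ℝ) ^ Hm := by
    rw [Fintype.card_fun, Fintype.card_bool, Fintype.card_fin]; push_cast; ring
  have h4 : (2 : ℝ) ^ p * ((2 : ℝ) ^ q * ((2 : ℝ) ^ Hm *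
      (1 / 4 * (2 : ℝ) ^ L * (distFail D (fun _ : Fin M → Bool => false) : ℝ)))) ≤
      ((univ.filter fun u : Fin (p + (L + Hm + M) + q) → Bool => ringWinU c y u = false).card : ℝ) := by
    rw [hLsum]
    push_cast
    rw [← hp, ← hconst]
    refine Finset.sum_le_sum fun a _ => ?_
    rw [← hq, ← hconst]
    refine Finset.sum_le_sum fun b _ => ?_
    rw [← hH, ← hconst]
    refine Finset.sum_le_sum fun h _ => ?_
    have h' := hfib a h b
    push_cast at h'
    exact h'
  -- wins and losses
  have htot : (univ.filter fun u : Fin (p + (L + Hm + M) + q) → Bool => ringWinU c y u = true).card +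
      (univ.filter fun u : Fin (p + (L + Hm + M) + q) → Bool => ringWinU c y u = false).card =
      2 ^ (p + (L + Hm + M) + q) := by
    have h := Finset.card_filter_add_card_filter_not
      (s := (univ : Finset (Fin (p + (L + Hm + M) + q) → Bool))) (fun u => ringWinU c y u = true)
    have hneg : (univ.filter fun u : Fin (p + (L + Hm + M) + q) → Bool => ¬ ringWinU c y u = true) =
        univ.filter fun u : Fin (p + (L + Hm + M) + q) → Bool => ringWinU c y u = false :=
      Finset.filter_congr fun u _ => by simp
    rw [hneg, Finset.card_univ, Fintype.card_fun, Fintype.card_bool, Fintype.card_fin] at h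
    exact h
  have htotR : ((univ.filter fun u : Fin (p + (L + Hm + M) + q) → Bool => ringWinU c y u = true).card : ℝ)
      + ((univ.filter fun u : Fin (p + (L + Hm + M) + q) → Bool => ringWinU c y u = false).card : ℝ) =
      (2 : ℝ) ^ (p + (L + Hm + M) + q) := by exact_mod_cast htot
  have hpow : (2 : ℝ) ^ (p + (L + Hm + M) + q) =
      (2 : ℝ) ^ p * ((2 : ℝ) ^ q * ((2 : ℝ) ^ Hm * ((2 : ℝ) ^ L * (2 : ℝ) ^ M))) := by
    rw [← pow_add, ← pow_add, ← pow_add, ← pow_add]; congr 1; omega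
  have key : η₀ / 4 * (2 : ℝ) ^ (p + (L + Hm + M) + q) ≤
      ((univ.filter fun u : Fin (p + (L + Hm + M) + q) → Bool => ringWinU c y u = false).card : ℝ) := by
    calc η₀ / 4 * (2 : ℝ) ^ (p + (L + Hm + M) + q)
        = (2 : ℝ) ^ p * ((2 : ℝ) ^ q * ((2 : ℝ) ^ Hm * (1 / 4 * (2 : ℝ) ^ L * (η₀ * (2 : ℝ) ^ M)))) := by
          rw [hpow]; ring
      _ ≤ (2 : ℝ) ^ p * ((2 : ℝ) ^ q * ((2 : ℝ) ^ Hm *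
          (1 / 4 * (2 : ℝ) ^ L * (distFail D (fun _ : Fin M → Bool => false) : ℝ)))) := by
          have hκL : (0 : ℝ) ≤ 1 / 4 * (2 : ℝ) ^ L := by positivity
          gcongr
      _ ≤ _ := h4
  linarith

end Summit.QuantumAdvantage.AdviceFreeQNC0

end
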